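import Mathlib
import HarnessLib

/-!
# Format C: the only asymptotic expansion the column tail needs — `1/(m² − n²)` as a geometric series

Route context: Fourier–Galerkin / Schur-complement certificates of Weil positivity on a window ("format C";
cell memo `run/shared/lean/pub/rh-explicit/rh-explicit-weil-10/FORMATC-DESIGN.md` §8.2/§8.4; supporting
stmt-RiemannHypothesis-0098).  Every off-diagonal piece of the window Gram in the Fourier basis (polar, exponential
sum, digamma, prime; Yoshida 1992 (5.15)/(5.16)) is `[n-data] × [known m-sequence] / (ω_m² − ω_n²)`, and
`ω_m² − ω_n² = (π/a)²(m² − n²)`.  The structured column tail of §8.4 expands ONLY the factor `1/(m² − n²)`: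

* `WeilFormatC.inv_sq_sub_sq_eq` — for `m ≠ 0`, `m² ≠ n²` and every `J`,
  `1/(m² − n²) = Σ_{j<J} n^{2j}/m^{2j+2} + (n/m)^{2J}/(m² − n²)` (exact; geometric sum with ratio `n²/m²`);
* `WeilFormatC.inv_sq_sub_sq_remainder_nonneg`, `WeilFormatC.inv_sq_sub_sq_remainder_le` — for `2|n| ≤ m`
  (so `m² − n² ≥ ¾m²`): `0 ≤ (n/m)^{2J}/(m² − n²) ≤ (4/3)·(n/m)^{2J}/m²`;
* `WeilFormatC.abs_inv_sq_sub_sq_sub_sum_le` — the packaged remainder estimate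
  `|1/(m² − n²) − Σ_{j<J} n^{2j}/m^{2j+2}| ≤ (4/3)·n^{2J}/m^{2J+2}`.

With this, the order-`J` tail of a column needs no Stirling/digamma asymptotics at all (the special sequences
`y_m = Im ψ(¼ + iω_m/2)`, `S0_m`, `S2_m`, `c_m`, `sin(ω_m ℓ)` stay as data), cf. §8.4.  Elementary; standard axioms.
-/

-- `Summit.RiemannHypothesis.RiemannHypothesis.…` is the layout-mandated namespace (summit = problem name).
set_option linter.dupNamespace false

namespace Summit.RiemannHypothesis.RiemannHypothesis.Theorems.WeilFormatC

open Finset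

/-- **Geometric expansion of `1/(m² − n²)`** (exact, any number of terms): for `m ≠ 0` and `m² ≠ n²`,
`1/(m² − n²) = Σ_{j<J} n^{2j}/m^{2j+2} + (n/m)^{2J}/(m² − n²)`. -/
theorem inv_sq_sub_sq_eq (m n : ℝ) (hm : m ≠ 0) (hmn : m ^ 2 ≠ n ^ 2) (J : ℕ) :
    1 / (m ^ 2 - n ^ 2)
      = (∑ j ∈ range J, n ^ (2 * j) / m ^ (2 * j + 2)) + (n / m) ^ (2 * J) / (m ^ 2 - n ^ 2) := by
  have hm2 : m ^ 2 ≠ 0 := pow_ne_zero 2 hm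
  have hd : m ^ 2 - n ^ 2 ≠ 0 := sub_ne_zero.mpr hmn
  set r : ℝ := n ^ 2 / m ^ 2 with hr
  have hr1 : r ≠ 1 := by
    intro h
    apply hmn
    rw [hr, div_eq_one_iff_eq hm2] at h
    exact h.symm
  -- the partial sum as a geometric sum
  have hsum : ∑ j ∈ range J, n ^ (2 * j) / m ^ (2 * j + 2) = (1 / m ^ 2) * ∑ j ∈ range J, r ^ j := by
    rw [Finset.mul_sum]
    refine Finset.sum_congr rfl fun j _ ↦ ?_
    rw [hr, div_pow, ← pow_mul, ← pow_mul, pow_add]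
    field_simp
  have hgeom : ∑ j ∈ range J, r ^ j = (r ^ J - 1) / (r - 1) := geom_sum_eq hr1 J
  have hrJ : (n / m) ^ (2 * J) = r ^ J := by
    rw [hr, pow_mul, div_pow]
  rw [hsum, hgeom, hrJ]
  have hr1' : r - 1 ≠ 0 := sub_ne_zero.mpr hr1
  have hrm : r - 1 = -(m ^ 2 - n ^ 2) / m ^ 2 := by
    rw [hr]; field_simp; ring
  rw [hrm]
  field_simp
  ring

/-- The remainder is nonnegative when `n² < m²`. -/
theorem inv_sq_sub_sq_remainder_nonneg (m n : ℝ) (hmn : n ^ 2 < m ^ 2) (J : ℕ) :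
    0 ≤ (n / m) ^ (2 * J) / (m ^ 2 - n ^ 2) := by
  have h1 : 0 ≤ (n / m) ^ (2 * J) := by rw [pow_mul]; positivity
  exact div_nonneg h1 (sub_pos.mpr hmn).le

/-- The remainder bound on the far range `2|n| ≤ m` (then `m² − n² ≥ ¾ m²`):
`(n/m)^{2J}/(m² − n²) ≤ (4/3)·(n/m)^{2J}/m²`. -/
theorem inv_sq_sub_sq_remainder_le (m n : ℝ) (hm : 0 < m) (hnm : 2 * |n| ≤ m) (J : ℕ) :
    (n / m) ^ (2 * J) / (m ^ 2 - n ^ 2) ≤ 4 / 3 * ((n / m) ^ (2 * J) / m ^ 2) := by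
  have hn2 : n ^ 2 ≤ m ^ 2 / 4 := by
    have h := pow_le_pow_left₀ (by positivity) hnm 2
    rw [mul_pow, sq_abs] at h
    linarith
  have hden : 3 / 4 * m ^ 2 ≤ m ^ 2 - n ^ 2 := by linarith
  have hpos : 0 < 3 / 4 * m ^ 2 := by positivity
  have h1 : 0 ≤ (n / m) ^ (2 * J) := by rw [pow_mul]; positivity
  calc (n / m) ^ (2 * J) / (m ^ 2 - n ^ 2) ≤ (n / m) ^ (2 * J) / (3 / 4 * m ^ 2) :=
        div_le_div_of_nonneg_left h1 hpos hden
    _ = 4 / 3 * ((n / m) ^ (2 * J) / m ^ 2) := by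
        field_simp

/-- **Packaged remainder estimate** for the structured column tail: for `0 < m`, `2|n| ≤ m` and every `J`,
`|1/(m² − n²) − Σ_{j<J} n^{2j}/m^{2j+2}| ≤ (4/3) · n^{2J}/m^{2J+2}`. -/
theorem abs_inv_sq_sub_sq_sub_sum_le (m n : ℝ) (hm : 0 < m) (hnm : 2 * |n| ≤ m) (J : ℕ) :
    |1 / (m ^ 2 - n ^ 2) - ∑ j ∈ range J, n ^ (2 * j) / m ^ (2 * j + 2)|
      ≤ 4 / 3 * (n ^ (2 * J) / m ^ (2 * J + 2)) := by
  have hn2 : n ^ 2 ≤ m ^ 2 / 4 := by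
    have h := pow_le_pow_left₀ (by positivity) hnm 2
    rw [mul_pow, sq_abs] at h
    linarith
  have hlt : n ^ 2 < m ^ 2 := by
    have : 0 < m ^ 2 := by positivity
    linarith
  have hne : m ^ 2 ≠ n ^ 2 := ne_of_gt hlt
  rw [inv_sq_sub_sq_eq m n hm.ne' hne J, add_sub_cancel_left,
    abs_of_nonneg (inv_sq_sub_sq_remainder_nonneg m n hlt J)]
  refine (inv_sq_sub_sq_remainder_le m n hm hnm J).trans (le_of_eq ?_)
  rw [div_pow, div_div, ← pow_add]

end Summit.RiemannHypothesis.RiemannHypothesis.Theorems.WeilFormatC
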